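import Literature.NumberTheory.Automorphic.RankinSelbergLocal
import Literature.NumberTheory.Automorphic.AutomorphicLFunction
import HarnessLib

/-!
# Local Godement–Jacquet zeta integrals and `L`-factors for `GL_n` over a `p`-adic field

Trunk `AutomorphicAxiomatic` (G19), topic `NumberTheory/Automorphic`. Third layer of the
decomposition of the named fact `Literature.NumberTheory.Automorphic.godementJacquet_hasMeromorphicContinuation`
(**lang.S21**; Godement–Jacquet, LNM 260 (1972), Thm. 13.8): the **non-archimedean local theory**
(LNM 260, §3 and §6; Jacquet, Corvallis (1979), Part 2, §1) feeding the Euler-factorisation fact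
`GodementJacquet1972_gjZeta_eulerFactorisation` of `GodementJacquetZetaIntegrals`.

Let `F` be a non-archimedean local field with residue cardinality `q` (`residueFieldCard F`) and
normalised absolute value `|·|` (`normAbs F`), `π` (here `ρ`) an irreducible admissible
representation of `GL_n(F)` on a complex vector space `V` (`Representation`, `IsAdmissible`,
Mathlib `Representation.IsIrreducible`), `Ṽ` its smooth contragredient (`ρ.contragredient`,
`SmoothRepresentation`). A **coefficient** of `π` is `f(g) = ⟨π(g) v, ṽ⟩ = ρ.matrixCoeff ṽ v g`
(`MatrixCoefficients`). For `Φ ∈ 𝒮(M_n(F))` (locally constant, compactly supported: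
`SchwartzBruhat` of `TateLocalFactors`) Godement–Jacquet form the local zeta integral

`Z(Φ, s, f) = ∫_{GL_n(F)} Φ(x) f(x) |det x|^s d×x`.

## Contents

* `intMatrices n F = M_n(𝒪_F) ⊆ M_n(F)`; `gjLocalIntegrand`, `gjLocalZeta μG Φ f s` (Bochner
  integral against an explicit measure `μG` on `GL_n(F)`, intended Haar; `[MeasurableSpace]` an
  instance argument, outline H7; the exponent is the plain `s` of LNM 260).
* `HasGJLFactor ρ μG P` — **the local `L`-factor as a predicate**, `L(s, π) = P(q^{-s})⁻¹`,
  `P ∈ ℂ[T]`, `P(0) = 1`, in the format of `HasRSLFactor` (`RankinSelbergLocal`) and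
  `HasTateGamma` (`TateLocalFactors`): (a) every `Z(Φ, s + (n-1)/2, f)` agrees for `re s ≫ 0`
  with `Q(q^{-s}, q^{s}) / P(q^{-s})`, `Q` Laurent (`IsLaurent`, `EqOnRightHalfPlane`, `rsLRat`,
  `evalAtQ`); (b) `P(q^{-s})⁻¹` itself is a finite `ℂ[q^{∓s}]`-combination of such zeta
  integrals. Jacquet's unitary shift `s + (n-1)/2` makes `L(s, π) = ∏ (1 - α_i q^{-s})⁻¹` for
  unramified `π` with Satake parameter `α` (Tamagawa's identity, `SatakeParametersGL`).
* Named facts (LNM 260): `GodementJacquet1972_local_convergence` (Thm. 3.3 (1)),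
  `GodementJacquet1972_local_existsUnique_hasGJLFactor` (Thm. 3.3 (2)),
  `GodementJacquet1972_hasGJLFactor_of_isSatakeParameter` (the unramified `L`-factor, §6 with
  Thm. 3.3; Jacquet (1979), (1.4)), `GodementJacquet1972_lemma610` (Lemma 6.10, the unramified
  computation `Z(1_{M_n(𝒪)}, s + (n-1)/2, ω°) = ∏ (1 - α_i q^{-s})⁻¹`).
* **Proved**: `HasGJLFactor.unique` — two polynomials with `HasGJLFactor ρ μG` coincide (the
  uniqueness half of Thm. 3.3 (2)), via `HasGJLFactor.exists_X_pow_mul_eq` (`P'/P` is a Laurent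
  polynomial: compare `1/P = ∑ Q_i Z_i` and `Z_i = R_i/P'` at the infinitely many points
  `q^{-k}`, `k ∈ ℕ` beyond all abscissas and poles) and the algebra
  `polynomial_eq_of_laurent_unit` (`X ∤ P, P'` as `P(0) = P'(0) = 1`); generic tools
  `ratFunc_eq_of_eval_eq_on_infinite` (a rational function over `ℂ` is determined by its values
  on an infinite set off the poles), `ratFunc_eval_finset_sum_of_denom_ne_zero`,
  `exists_forall_eval_inv_pow_ne_zero`, `IsLaurent.mul/add/sum`, `evalAtQ_natCast`;
  `existsUnique_hasGJLFactor_of_exists` reduces the `∃!` fact to existence; small API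
  (`mem_intMatrices_iff`, `one_mem_intMatrices`, `zero_mem_intMatrices`, `gjLocalZeta_zero`,
  `HasGJLFactor.eval_zero/ne_zero`).

The local functional equation (Thm. 3.3 (3)–(4): `γ`-factor and Fourier transform on `M_n(F)`)
and the archimedean theory (§8) are not needed for lang.S21's meromorphic continuation beyond the
meromorphy/non-vanishing recorded in `GodementJacquetZetaIntegrals`, and are left to a sibling
file.

## Conventions check (shift and orientation, via Tamagawa's identity)

`IsSatakeParameter ρ ϖ α` (`SatakeParametersGL`): `T_i v° = q^{i(n-i)/2} e_i(α) v°` for the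
Hecke operators `T_i = [K diag(ϖ^{(i)}, 1^{(n-i)}) K]`, `K = GL_n(𝒪_F)`. For the zonal coefficient
`ω°(g) = ⟨π(g) v°, ṽ°⟩` (`ṽ°(v°) = 1`, both `K`-fixed) and `vol(K) = 1`,
`∫_{K t K} ω° = (eigenvalue λ_t of [K t K] on v°)`, so
`Z(1_{M_n(𝒪)}, s', ω°) = ∑_t λ_t q^{-v(det t) s'}` is Tamagawa's formal Hecke series, equal to
`(∑_i (-1)^i q^{i(i-1)/2} T_i X^i)⁻¹` at `X = q^{-s'}` (Tamagawa (1963); Shimura, Thm. 3.21; the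
tree's `heckePolynomial_eq_satakePolynomial`): with `T_i ↦ q^{i(n-i)/2} e_i(α)` the denominator is
`∏_j (1 - q^{(n-1)/2} α_j X)`, i.e. `∏_j (1 - α_j q^{-s})` at `s' = s + (n-1)/2`. This fixes both
the shift and the orientation used below and in `GodementJacquetZetaIntegrals`; for `n = 1` it
is Tate's `∫_{𝒪 ∖ 0} χ(x) |x|^s d×x = (1 - χ(ϖ) q^{-s})⁻¹`.

## References

* R. Godement, H. Jacquet, *Zeta functions of simple algebras*, LNM 260 (1972), §3 (Thm. 3.3),
  §6 (Lemma 6.10) [GodementJacquet1972] (not held; theorem numbers as cited by lang.S21 and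
  standard in the literature).
* H. Jacquet, *Principal `L`-functions of the linear group*, Proc. Sympos. Pure Math. 33 (1979),
  Part 2, §1 ((1.1)–(1.4)) [JacquetCorvallis1979].
* S. Gelbart, *Automorphic forms on adele groups* (1975), §6, p. 83 (the case `n = 2`: the local
  integrals converge for `re s ≫ 0`, continue meromorphically, `ζ_v / L(s, π_v)` is entire and a
  finite sum of such quotients is a non-zero constant; read) [Gelbart1975].
* W.-W. Li, *Zeta integrals, Schwartz spaces and local functional equations*, LNM 2228 (2018),
  §1.1.1 and §6.4 (read) [Li2018].
* T. Tamagawa, *On the ζ-functions of a division algebra*, Ann. of Math. 77 (1963); G. Shimura,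
  *Introduction to the arithmetic theory of automorphic functions*, Thm. 3.21.
-/

set_option autoImplicit false

open scoped NNReal MatrixGroups
open Matrix MeasureTheory Polynomial ValuativeRel Literature.NumberTheory.GaloisRepresentations.IsNonarchimedeanLocalField

noncomputable section

namespace Literature.NumberTheory.Automorphic

/-! ### Integral matrices and the local zeta integral -/

section IntMatrices

variable {n : ℕ} {F : Type*} [Field F] [ValuativeRel F]

variable (n F) in
/-- The integral matrices `M_n(𝒪_F) ⊆ M_n(F)` (all entries in the valuation ring `𝒪[F]`), the
support of the unramified test function `Φ° = 1_{M_n(𝒪_F)}` of Godement–Jacquet (1972), §6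
(Lemma 6.10) and Jacquet (1979), (1.4). Compare `glInt n F = GL_n(𝒪_F)` (`ReductiveGroupData`),
the invertible integral matrices with integral inverse. [cite: GodementJacquet1972, Lemma 6.10] -/
def intMatrices : Set (Matrix (Fin n) (Fin n) F) :=
  {x | ∀ i j, x i j ∈ 𝒪[F]}

/-- Membership in `M_n(𝒪_F)`: all entries are integral. [folklore] -/
@[simp]
theorem mem_intMatrices_iff (x : Matrix (Fin n) (Fin n) F) :
    x ∈ intMatrices n F ↔ ∀ i j, x i j ∈ 𝒪[F] :=
  Iff.rfl

/-- `0 ∈ M_n(𝒪_F)`. [folklore] -/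
theorem zero_mem_intMatrices : (0 : Matrix (Fin n) (Fin n) F) ∈ intMatrices n F :=
  fun _ _ => zero_mem _

/-- `1 ∈ M_n(𝒪_F)`. [folklore] -/
theorem one_mem_intMatrices : (1 : Matrix (Fin n) (Fin n) F) ∈ intMatrices n F := by
  intro i j
  by_cases h : i = j
  · subst h; simp
  · simp [Matrix.one_apply_ne h]

/-- Elements of `GL_n(𝒪_F)` have integral entries: `glInt n F ⊆ M_n(𝒪_F)` (as matrices).
[folklore] -/
theorem coe_mem_intMatrices_of_mem_glInt {g : GL (Fin n) F} (hg : g ∈ glInt n F) :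
    ((g : GL (Fin n) F) : Matrix (Fin n) (Fin n) F) ∈ intMatrices n F :=
  ((mem_glInt_iff g).mp hg).1

end IntMatrices

section Defs

variable {n : ℕ} {F : Type*} [Field F] [ValuativeRel F] [TopologicalSpace F]
  [IsNonarchimedeanLocalField F]

/-- The integrand `x ↦ Φ(x) f(x) |det x|_F^s` of the local Godement–Jacquet zeta integral, with
the normalised absolute value `normAbs F` of the local field (`|ϖ| = q⁻¹`) and the principal
complex power of the positive real `|det x|` (Godement–Jacquet (1972), §3; Jacquet (1979),
(1.1)). [cite: GodementJacquet1972, Thm. 3.3] -/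
def gjLocalIntegrand (Φ : Matrix (Fin n) (Fin n) F → ℂ) (f : GL (Fin n) F → ℂ) (s : ℂ)
    (x : GL (Fin n) F) : ℂ :=
  Φ x * f x * (((normAbs F ((Matrix.GeneralLinearGroup.det x : Fˣ) : F) : ℝ≥0) : ℝ) : ℂ) ^ s

/-- The **local Godement–Jacquet zeta integral**
`Z(Φ, s, f) = ∫_{GL_n(F)} Φ(x) f(x) |det x|^s dμG(x)` of a test function `Φ` on `M_n(F)`
(intended: `Φ ∈ 𝒮(M_n(F))`, `SchwartzBruhat`), a function `f` on `GL_n(F)` (intended: a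
coefficient `ρ.matrixCoeff ṽ v` of an admissible representation) and a measure `μG` on `GL_n(F)`
(intended: a Haar measure): a Bochner integral, equal to the absolutely convergent integral of
the source for `re s ≫ 0` (Thm. 3.3 (1)) and to the junk value `0` where the integrand is not
integrable. Exponent: the plain `s` of LNM 260; the unitary shift `s + (n-1)/2` of Jacquet (1979)
appears in `HasGJLFactor`. For `n = 1` this is Tate's local zeta integral (`tateZeta` of
`TateLocalFactors`, up to `GL_1(F) = Fˣ`). (Godement–Jacquet (1972), §3; Jacquet (1979), (1.1);
Gelbart (1975), §6, p. 83 for `n = 2`.) [cite: GodementJacquet1972, Thm. 3.3] -/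
def gjLocalZeta [MeasurableSpace (GL (Fin n) F)] (μG : Measure (GL (Fin n) F))
    (Φ : Matrix (Fin n) (Fin n) F → ℂ) (f : GL (Fin n) F → ℂ) (s : ℂ) : ℂ :=
  ∫ x, gjLocalIntegrand Φ f s x ∂μG

/-- Unfolding the local zeta integral. [folklore] -/
theorem gjLocalZeta_def [MeasurableSpace (GL (Fin n) F)] (μG : Measure (GL (Fin n) F))
    (Φ : Matrix (Fin n) (Fin n) F → ℂ) (f : GL (Fin n) F → ℂ) (s : ℂ) :
    gjLocalZeta μG Φ f s = ∫ x, Φ x * f x *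
      (((normAbs F ((Matrix.GeneralLinearGroup.det x : Fˣ) : F) : ℝ≥0) : ℝ) : ℂ) ^ s ∂μG :=
  rfl

/-- The local zeta integral of the zero test function vanishes. [folklore] -/
@[simp]
theorem gjLocalZeta_zero [MeasurableSpace (GL (Fin n) F)] (μG : Measure (GL (Fin n) F))
    (f : GL (Fin n) F → ℂ) (s : ℂ) : gjLocalZeta μG 0 f s = 0 := by
  simp [gjLocalZeta, gjLocalIntegrand]

/-- The local zeta integral of the zero coefficient vanishes. [folklore] -/
@[simp]
theorem gjLocalZeta_zero_right [MeasurableSpace (GL (Fin n) F)] (μG : Measure (GL (Fin n) F))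
    (Φ : Matrix (Fin n) (Fin n) F → ℂ) (s : ℂ) : gjLocalZeta μG Φ 0 s = 0 := by
  simp [gjLocalZeta, gjLocalIntegrand]

/-! ### The local `L`-factor as a predicate -/

variable {V : Type*} [AddCommGroup V] [Module ℂ V]

/-- **The local Godement–Jacquet `L`-factor as a predicate**: `L(s, π) = P(q^{-s})⁻¹` with
`P ∈ ℂ[T]`, `P(0) = 1`, meaning (Godement–Jacquet (1972), Thm. 3.3 (2); Jacquet (1979), §1,
(1.2)–(1.3)): (a) for every Schwartz–Bruhat `Φ` on `M_n(F)` and every coefficient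
`f = ρ.matrixCoeff ṽ v` (`ṽ ∈ Ṽ` the smooth contragredient, `v ∈ V`) the shifted zeta integral
`Z(Φ, s + (n-1)/2, f)` agrees for `re s ≫ 0` with `Q(q^{-s}, q^{s}) / P(q^{-s})` for a Laurent
polynomial `Q`; (b) `P(q^{-s})⁻¹` itself is a finite `ℂ[q^{-s}, q^{s}]`-combination of such zeta
integrals — so the zeta integrals span exactly the fractional ideal `L(s, π) ℂ[q^{-s}, q^{s}]`,
"the `L`-factor is the g.c.d. of the zeta integrals". Same bookkeeping (`IsLaurent`,
`EqOnRightHalfPlane`, `rsLRat`, `evalAtQ`) as `HasRSLFactor` of `RankinSelbergLocal`; the measure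
`μG` on `GL_n(F)` is a parameter (intended: Haar; a positive rescaling does not affect the
predicate). With `P(0) = 1` such a `P` is unique
(`GodementJacquet1972_local_existsUnique_hasGJLFactor`). [cite: GodementJacquet1972, Thm. 3.3] -/
def HasGJLFactor [MeasurableSpace (GL (Fin n) F)] (ρ : Representation ℂ (GL (Fin n) F) V)
    (μG : Measure (GL (Fin n) F)) (P : ℂ[X]) : Prop :=
  P.eval 0 = 1 ∧
  (∀ Φ ∈ SchwartzBruhat (Matrix (Fin n) (Fin n) F), ∀ φ ∈ ρ.contragredient, ∀ v : V,
    ∃ R : RatFunc ℂ, IsLaurent R ∧ EqOnRightHalfPlane (residueFieldCard F)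
      (fun s => gjLocalZeta μG Φ (ρ.matrixCoeff φ v) (s + ((n : ℂ) - 1) / 2)) (R * rsLRat P)) ∧
  ∃ (k : ℕ) (Φ : Fin k → Matrix (Fin n) (Fin n) F → ℂ) (φ : Fin k → Module.Dual ℂ V)
    (v : Fin k → V) (Q : Fin k → RatFunc ℂ),
    (∀ i, Φ i ∈ SchwartzBruhat (Matrix (Fin n) (Fin n) F)) ∧ (∀ i, φ i ∈ ρ.contragredient) ∧
    (∀ i, IsLaurent (Q i)) ∧
    EqOnRightHalfPlane (residueFieldCard F)
      (fun s => ∑ i, evalAtQ (residueFieldCard F) (Q i) s *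
        gjLocalZeta μG (Φ i) (ρ.matrixCoeff (φ i) (v i)) (s + ((n : ℂ) - 1) / 2))
      (rsLRat P)

/-- The `L`-polynomial of `HasGJLFactor` has constant term `1`. [folklore] -/
theorem HasGJLFactor.eval_zero [MeasurableSpace (GL (Fin n) F)]
    {ρ : Representation ℂ (GL (Fin n) F) V} {μG : Measure (GL (Fin n) F)} {P : ℂ[X]}
    (h : HasGJLFactor ρ μG P) : P.eval 0 = 1 :=
  h.1

/-- The `L`-polynomial of `HasGJLFactor` is non-zero. [folklore] -/
theorem HasGJLFactor.ne_zero [MeasurableSpace (GL (Fin n) F)]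
    {ρ : Representation ℂ (GL (Fin n) F) V} {μG : Measure (GL (Fin n) F)} {P : ℂ[X]}
    (h : HasGJLFactor ρ μG P) : P ≠ 0 := fun hP => by
  have h0 : P.eval 0 = 1 := h.1
  rw [hP, Polynomial.eval_zero] at h0
  exact zero_ne_one h0

end Defs

/-! ### Uniqueness of the `L`-polynomial (proved) -/

section Uniqueness

/-- Two rational functions over `ℂ` whose evaluations agree on an infinite set avoiding the zeros
of both (reduced) denominators are equal (cross-multiplication and
`Polynomial.eq_zero_of_infinite_isRoot`). [folklore] -/
theorem ratFunc_eq_of_eval_eq_on_infinite {R R' : RatFunc ℂ} {S : Set ℂ} (hS : S.Infinite)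
    (hd : ∀ t ∈ S, (R.denom).eval t ≠ 0) (hd' : ∀ t ∈ S, (R'.denom).eval t ≠ 0)
    (h : ∀ t ∈ S, R.eval (RingHom.id ℂ) t = R'.eval (RingHom.id ℂ) t) : R = R' := by
  -- the polynomial `num R * denom R' - num R' * denom R` vanishes on `S`
  set D : ℂ[X] := R.num * R'.denom - R'.num * R.denom with hD
  have hroot : S ⊆ {t | D.IsRoot t} := by
    intro t ht
    have h1 := h t ht
    simp only [RatFunc.eval, Polynomial.eval₂_id] at h1
    change R.num.eval t / R.denom.eval t = R'.num.eval t / R'.denom.eval t at h1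
    rw [div_eq_div_iff (hd t ht) (hd' t ht)] at h1
    simp only [Set.mem_setOf_eq, IsRoot, hD, eval_sub, eval_mul]
    rw [h1]; ring
  have hD0 : D = 0 := Polynomial.eq_zero_of_infinite_isRoot D (hS.mono hroot)
  have hmul : R.num * R'.denom = R'.num * R.denom := sub_eq_zero.mp (by rw [← hD]; exact hD0)
  have hden : (algebraMap ℂ[X] (RatFunc ℂ) R.denom) ≠ 0 :=
    (map_ne_zero_iff _ (IsFractionRing.injective ℂ[X] (RatFunc ℂ))).mpr (RatFunc.denom_ne_zero R)
  have hden' : (algebraMap ℂ[X] (RatFunc ℂ) R'.denom) ≠ 0 :=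
    (map_ne_zero_iff _ (IsFractionRing.injective ℂ[X] (RatFunc ℂ))).mpr (RatFunc.denom_ne_zero R')
  rw [← RatFunc.num_div_denom R, ← RatFunc.num_div_denom R', div_eq_div_iff hden hden',
    ← map_mul, ← map_mul, hmul]

/-- For `1 < q` and finitely many non-zero polynomials, the points `T = q^{-k}` (`k ∈ ℕ` large) are
not roots: there is `k₀` such that for all `k ≥ k₀` and all `i`, `(p i).eval (q ^ k)⁻¹ ≠ 0` (the
non-zero roots have norms bounded below by some `m > 0`, and `q^{-k} < m` eventually). [folklore] -/
theorem exists_forall_eval_inv_pow_ne_zero {ι : Type*} [Finite ι] {q : ℕ} (hq : 1 < q)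
    (p : ι → ℂ[X]) (hp : ∀ i, p i ≠ 0) :
    ∃ k₀ : ℕ, ∀ k, k₀ ≤ k → ∀ i, (p i).eval (((q : ℂ) ^ k)⁻¹) ≠ 0 := by
  classical
  haveI := Fintype.ofFinite ι
  -- the finite set of norms of non-zero roots of all `p i`
  set T : Finset ℝ :=
    (Finset.univ.biUnion fun i => ((p i).roots.toFinset.filter (· ≠ 0))).image (‖·‖) with hT
  -- a positive lower bound `m` for these norms
  obtain ⟨m, hm0, hm⟩ : ∃ m : ℝ, 0 < m ∧ ∀ r ∈ T, m ≤ r := by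
    by_cases hne : T.Nonempty
    · refine ⟨T.min' hne, ?_, fun r hr => T.min'_le r hr⟩
      obtain ⟨z, hz, hzmin⟩ := Finset.mem_image.mp (T.min'_mem hne)
      rw [← hzmin]
      simp only [Finset.mem_biUnion, Finset.mem_univ, true_and, Finset.mem_filter] at hz
      obtain ⟨i, -, hz0⟩ := hz
      exact norm_pos_iff.mpr hz0
    · exact ⟨1, one_pos, fun r hr => (hne ⟨r, hr⟩).elim⟩
  -- `q^{-k} < m` for `k ≥ k₀`
  have hq1 : (1 : ℝ) < q := by exact_mod_cast hq
  have hqinv : ((q : ℝ))⁻¹ < 1 := inv_lt_one_of_one_lt₀ hq1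
  have hqinv0 : 0 ≤ ((q : ℝ))⁻¹ := by positivity
  obtain ⟨k₀, hk₀⟩ := exists_pow_lt_of_lt_one hm0 hqinv
  refine ⟨k₀, fun k hk i hroot => ?_⟩
  -- `t = (q^k)⁻¹` is a non-zero root of `p i` of norm `< m`: contradiction
  set t : ℂ := ((q : ℂ) ^ k)⁻¹ with ht
  have ht0 : t ≠ 0 := by
    rw [ht]; exact inv_ne_zero (pow_ne_zero _ (by exact_mod_cast (by omega : q ≠ 0)))
  have hnorm : ‖t‖ < m := by
    rw [ht, norm_inv, norm_pow, Complex.norm_natCast, ← inv_pow]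
    exact lt_of_le_of_lt (pow_le_pow_of_le_one hqinv0 hqinv.le hk) hk₀
  have hmem : ‖t‖ ∈ T := by
    rw [hT, Finset.mem_image]
    refine ⟨t, ?_, rfl⟩
    simp only [Finset.mem_biUnion, Finset.mem_univ, true_and, Finset.mem_filter,
      Multiset.mem_toFinset]
    exact ⟨i, (Polynomial.mem_roots (hp i)).mpr hroot, ht0⟩
  exact (not_le.mpr hnorm) (hm _ hmem)




/-- Evaluation of a finite sum of rational functions at a point where no summand's denominator
vanishes is the sum of the evaluations, and the sum's denominator does not vanish there (Mathlib
`RatFunc.eval_add`, `RatFunc.denom_add_dvd`). [folklore] -/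
theorem ratFunc_eval_finset_sum_of_denom_ne_zero {ι : Type*} (s : Finset ι) (x : ι → RatFunc ℂ)
    (a : ℂ) (h : ∀ i ∈ s, ((x i).denom).eval a ≠ 0) :
    (RatFunc.eval (RingHom.id ℂ) a (∑ i ∈ s, x i) = ∑ i ∈ s, RatFunc.eval (RingHom.id ℂ) a (x i)) ∧
      ((∑ i ∈ s, x i).denom).eval a ≠ 0 := by
  classical
  induction s using Finset.induction_on with
  | empty => simp [RatFunc.denom_zero]
  | @insert j s hj ih =>
    have hj' : ((x j).denom).eval a ≠ 0 := h j (Finset.mem_insert_self j s)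
    have ih' := ih fun i hi => h i (Finset.mem_insert_of_mem hi)
    rw [Finset.sum_insert hj, Finset.sum_insert hj]
    have hden : ((x j + ∑ i ∈ s, x i).denom).eval a ≠ 0 := by
      intro h0
      have hdvd := RatFunc.denom_add_dvd (x j) (∑ i ∈ s, x i)
      have := Polynomial.eval_eq_zero_of_dvd_of_eval_eq_zero hdvd h0
      rw [eval_mul] at this
      rcases mul_eq_zero.mp this with h1 | h1
      · exact hj' h1
      · exact ih'.2 h1
    refine ⟨?_, hden⟩
    rw [RatFunc.eval_add (RingHom.id ℂ) a (by simpa [Polynomial.eval₂_id] using hj')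
      (by simpa [Polynomial.eval₂_id] using ih'.2), ih'.1]

/-- Algebraic core of the uniqueness of `L`-polynomials: if `P(0) = P'(0) = 1` and
`X^i P' = a P`, `X^j P = b P'` for polynomials `a`, `b` (i.e. `P'/P` and `P/P'` are Laurent
polynomials), then `P = P'`: `X` is prime and divides neither `P` nor `P'`, so `X^i ∣ a`,
`X^j ∣ b`, whence `P' = a₁ P`, `P = b₁ P'` with `b₁ a₁ = 1`, `a₁ = C c`, and `c = 1` at `X = 0`.
[folklore] -/
theorem polynomial_eq_of_laurent_unit {P P' a b : ℂ[X]} (hP : P.eval 0 = 1) (hP' : P'.eval 0 = 1)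
    {i j : ℕ} (ha : X ^ i * P' = a * P) (hb : X ^ j * P = b * P') : P = P' := by
  have hP0 : P ≠ 0 := by rintro rfl; simp at hP
  have hP'0 : P' ≠ 0 := by rintro rfl; simp at hP'
  have hXP : ¬ X ∣ P := by
    intro h
    have := Polynomial.eval_eq_zero_of_dvd_of_eval_eq_zero h (eval_X (x := (0 : ℂ)))
    simp [hP] at this
  have hXP' : ¬ X ∣ P' := by
    intro h
    have := Polynomial.eval_eq_zero_of_dvd_of_eval_eq_zero h (eval_X (x := (0 : ℂ)))
    simp [hP'] at this
  -- `X^i ∣ a` and `X^j ∣ b`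
  obtain ⟨a₁, rfl⟩ : X ^ i ∣ a :=
    Polynomial.prime_X.pow_dvd_of_dvd_mul_right i hXP ⟨P', by rw [ha]⟩
  obtain ⟨b₁, rfl⟩ : X ^ j ∣ b :=
    Polynomial.prime_X.pow_dvd_of_dvd_mul_right j hXP' ⟨P, by rw [hb]⟩
  have hXi : (X : ℂ[X]) ^ i ≠ 0 := pow_ne_zero _ X_ne_zero
  have hXj : (X : ℂ[X]) ^ j ≠ 0 := pow_ne_zero _ X_ne_zero
  have ha' : P' = a₁ * P := mul_left_cancel₀ hXi (by rw [ha]; ring)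
  have hb' : P = b₁ * P' := mul_left_cancel₀ hXj (by rw [hb]; ring)
  -- `b₁ a₁ = 1`, so `a₁` is a unit, a constant `c` with `c = 1`
  have hunit : b₁ * a₁ = 1 := by
    have : (b₁ * a₁) * P = 1 * P := by
      calc (b₁ * a₁) * P = b₁ * (a₁ * P) := by ring
        _ = P := by rw [← ha', ← hb']
        _ = 1 * P := (one_mul P).symm
    exact mul_right_cancel₀ hP0 this
  have ha₁u : IsUnit a₁ := IsUnit.of_mul_eq_one b₁ (by rw [mul_comm]; exact hunit)
  obtain ⟨c, hc, hca⟩ := Polynomial.isUnit_iff.mp ha₁u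
  have hc1 : c = 1 := by
    have := congrArg (Polynomial.eval 0) ha'
    rw [eval_mul, ← hca, eval_C, hP, hP', mul_one] at this
    exact this.symm
  rw [ha', ← hca, hc1, C_1, one_mul]


/-- Laurent polynomials are closed under multiplication. [folklore] -/
theorem IsLaurent.mul {R R' : RatFunc ℂ} (h : IsLaurent R) (h' : IsLaurent R') :
    IsLaurent (R * R') := by
  obtain ⟨Q, k, rfl⟩ := h
  obtain ⟨Q', k', rfl⟩ := h'
  refine ⟨Q * Q', k + k', ?_⟩
  rw [map_mul, pow_add, div_mul_div_comm]

/-- Laurent polynomials are closed under addition. [folklore] -/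
theorem IsLaurent.add {R R' : RatFunc ℂ} (h : IsLaurent R) (h' : IsLaurent R') :
    IsLaurent (R + R') := by
  obtain ⟨Q, k, rfl⟩ := h
  obtain ⟨Q', k', rfl⟩ := h'
  refine ⟨Q * X ^ k' + Q' * X ^ k, k + k', ?_⟩
  have hX : (RatFunc.X : RatFunc ℂ) ≠ 0 := RatFunc.X_ne_zero
  rw [div_add_div _ _ (pow_ne_zero _ hX) (pow_ne_zero _ hX), map_add, map_mul, map_mul, map_pow,
    map_pow, RatFunc.algebraMap_X, pow_add]
  ring

/-- `0` is a Laurent polynomial. [folklore] -/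
theorem isLaurent_zero : IsLaurent (0 : RatFunc ℂ) :=
  ⟨0, 0, by simp⟩

/-- Finite sums of Laurent polynomials are Laurent polynomials. [folklore] -/
theorem IsLaurent.sum {ι : Type*} (s : Finset ι) {R : ι → RatFunc ℂ}
    (h : ∀ i ∈ s, IsLaurent (R i)) : IsLaurent (∑ i ∈ s, R i) := by
  classical
  induction s using Finset.induction_on with
  | empty => simpa using isLaurent_zero
  | @insert j s hj ih =>
    rw [Finset.sum_insert hj]
    exact (h j (Finset.mem_insert_self j s)).add (ih fun i hi => h i (Finset.mem_insert_of_mem hi))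

/-- `evalAtQ q R k = R((q^k)⁻¹)` at a natural number `k` (`q^{-k} = (q^k)⁻¹`). [folklore] -/
theorem evalAtQ_natCast (q k : ℕ) (R : RatFunc ℂ) :
    evalAtQ q R (k : ℂ) = R.eval (RingHom.id ℂ) (((q : ℂ) ^ k)⁻¹) := by
  rw [evalAtQ, Complex.cpow_neg, Complex.cpow_natCast]

variable {F : Type*} [Field F] [ValuativeRel F] [TopologicalSpace F] [IsNonarchimedeanLocalField F]
  {n : ℕ} {V : Type*} [AddCommGroup V] [Module ℂ V]

/-- **One direction of the uniqueness of the `L`-polynomial.** If `P` and `P'` both satisfy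
`HasGJLFactor ρ μG`, then `X^i P' = a P` for some polynomial `a` and `i ∈ ℕ`, i.e. `P'/P` is a
Laurent polynomial: by (b) for `P`, `P(q^{-s})⁻¹ = ∑_i Q_i(s) Z_i(s)` on a right half-plane, and
by (a) for `P'` each `Z_i = R_i(q^{-s}) / P'(q^{-s})` there with `R_i` Laurent; comparing the two
rational functions at the infinitely many points `q^{-k}`, `k ∈ ℕ` large (beyond all abscissas
and all poles, `exists_forall_eval_inv_pow_ne_zero`), gives `1/P = (∑ Q_i R_i)/P'` in `ℂ(T)`
(`ratFunc_eq_of_eval_eq_on_infinite`). Godement–Jacquet (1972), proof of Thm. 3.3 (the ideal of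
zeta integrals has a unique generator `P(q^{-s})⁻¹` with `P(0) = 1`). [folklore] -/
theorem HasGJLFactor.exists_X_pow_mul_eq [MeasurableSpace (GL (Fin n) F)]
    {ρ : Representation ℂ (GL (Fin n) F) V} {μG : Measure (GL (Fin n) F)} {P P' : ℂ[X]}
    (h : HasGJLFactor ρ μG P) (h' : HasGJLFactor ρ μG P') :
    ∃ (a : ℂ[X]) (i : ℕ), (X : ℂ[X]) ^ i * P' = a * P := by
  classical
  set q : ℕ := residueFieldCard F with hq_def
  have hq : 1 < q := one_lt_residueFieldCard F
  obtain ⟨k, Φ, φ, v, Q, hΦ, hφ, hQ, c₀, hc₀⟩ := h.2.2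
  choose R hR c hc using fun i => h'.2.1 (Φ i) (hΦ i) (φ i) (hφ i) (v i)
  -- the Laurent polynomial `L = ∑ Q_i R_i = Lp / X^m`
  set L : RatFunc ℂ := ∑ i, Q i * R i with hL_def
  obtain ⟨Lp, m, hLm⟩ : IsLaurent L :=
    IsLaurent.sum _ fun i _ => (hQ i).mul (hR i)
  -- abscissa beyond `c₀` and all `c i`
  set B : ℝ := max c₀ 0 + ∑ i, max (c i) 0 with hB
  have hBc₀ : c₀ ≤ B := by
    have h1 : c₀ ≤ max c₀ 0 := le_max_left _ _
    have h2 : 0 ≤ ∑ i, max (c i) 0 := Finset.sum_nonneg fun i _ => le_max_right _ _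
    linarith
  have hBc : ∀ i, c i ≤ B := by
    intro i
    have h1 : c i ≤ max (c i) 0 := le_max_left _ _
    have h2 : max (c i) 0 ≤ ∑ j, max (c j) 0 :=
      Finset.single_le_sum (f := fun j => max (c j) 0) (fun j _ => le_max_right _ _)
        (Finset.mem_univ i)
    have h3 : 0 ≤ max c₀ 0 := le_max_right _ _
    linarith
  set K₁ : ℕ := ⌈B⌉₊ + 1 with hK₁
  have hK₁B : B < K₁ := by
    have := Nat.le_ceil B
    push_cast [hK₁]
    linarith
  -- beyond all poles: the denominators of all rational functions involved
  let den : (Fin k × Fin 3) ⊕ Fin 4 → ℂ[X] := fun j =>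
    match j with
    | Sum.inl (i, 0) => (Q i).denom
    | Sum.inl (i, 1) => (R i).denom
    | Sum.inl (i, 2) => (Q i * R i).denom
    | Sum.inr 0 => (rsLRat P).denom
    | Sum.inr 1 => (rsLRat P').denom
    | Sum.inr 2 => L.denom
    | Sum.inr 3 => (L * rsLRat P').denom
  obtain ⟨k₀, hk₀⟩ := exists_forall_eval_inv_pow_ne_zero hq den fun j => by
    rcases j with ⟨i, j⟩ | j
    · fin_cases j <;> exact RatFunc.denom_ne_zero _
    · fin_cases j <;> exact RatFunc.denom_ne_zero _
  set K : ℕ := max K₁ k₀ with hK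
  -- the infinite set of sample points
  set t : ℕ → ℂ := fun j => ((q : ℂ) ^ j)⁻¹ with ht
  have ht_inj : Function.Injective t := by
    intro j j' hjj'
    have h1 : ((q : ℂ) ^ j) = (q : ℂ) ^ j' := inv_injective hjj'
    have h2 : ((q ^ j : ℕ) : ℂ) = ((q ^ j' : ℕ) : ℂ) := by push_cast; exact h1
    exact Nat.pow_right_injective hq (Nat.cast_injective h2)
  have hS : (t '' Set.Ici K).Infinite := (Set.Ici_infinite K).image ht_inj.injOn
  -- denominators do not vanish on the sample points
  have hden : ∀ j ∈ Set.Ici K, ∀ l, (den l).eval (t j) ≠ 0 := fun j hj l =>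
    hk₀ j (le_trans (le_max_right _ _) hj) l
  -- the key identity of rational functions `1/P = L/P'`
  have hkey : rsLRat P = L * rsLRat P' := by
    refine ratFunc_eq_of_eval_eq_on_infinite hS ?_ ?_ ?_
    · rintro _ ⟨j, hj, rfl⟩; exact hden j hj (Sum.inr 0)
    · rintro _ ⟨j, hj, rfl⟩; exact hden j hj (Sum.inr 3)
    · rintro _ ⟨j, hj, rfl⟩
      have hjK₁ : (K₁ : ℝ) ≤ j := by exact_mod_cast le_trans (le_max_left _ _) hj
      have hre : ((j : ℂ)).re = (j : ℝ) := by simp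
      have hjc₀ : c₀ < ((j : ℂ)).re := by rw [hre]; linarith
      have hjc : ∀ i, c i < ((j : ℂ)).re := fun i => by rw [hre]; linarith [hBc i]
      -- evaluate both sides at `s = j`
      have e2 : ∀ l, Polynomial.eval₂ (RingHom.id ℂ) (t j) (den l) ≠ 0 := fun l => by
        rw [Polynomial.eval₂_id]; exact hden j hj l
      have lhs := hc₀ (j : ℂ) hjc₀
      dsimp only at lhs
      rw [← hq_def, evalAtQ_natCast] at lhs
      -- `∑ Q_i(s) Z_i(s) = (∑ Q_i R_i)(t) * (1/P')(t)`
      have step : ∑ i, evalAtQ q (Q i) (j : ℂ) *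
          gjLocalZeta μG (Φ i) (ρ.matrixCoeff (φ i) (v i)) ((j : ℂ) + ((n : ℂ) - 1) / 2) =
          (L * rsLRat P').eval (RingHom.id ℂ) (t j) := by
        have hsum := ratFunc_eval_finset_sum_of_denom_ne_zero Finset.univ (fun i => Q i * R i) (t j)
          (fun i _ => hden j hj (Sum.inl (i, 2)))
        rw [RatFunc.eval_mul (RingHom.id ℂ) (t j) (e2 (Sum.inr 2)) (e2 (Sum.inr 1)), hsum.1,
          Finset.sum_mul]
        refine Finset.sum_congr rfl fun i _ => ?_
        have hci := hc i (j : ℂ) (hjc i)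
        dsimp only at hci
        rw [← hq_def] at hci
        rw [hci, evalAtQ_natCast, evalAtQ_natCast,
          RatFunc.eval_mul (RingHom.id ℂ) (t j) (e2 (Sum.inl (i, 1))) (e2 (Sum.inr 1)),
          RatFunc.eval_mul (RingHom.id ℂ) (t j) (e2 (Sum.inl (i, 0))) (e2 (Sum.inl (i, 1))),
          mul_assoc]
      rw [← lhs, step]
  -- clear denominators: `X^m * P' = Lp * P`
  refine ⟨Lp, m, ?_⟩
  have hinj := IsFractionRing.injective ℂ[X] (RatFunc ℂ)
  have hP : (algebraMap ℂ[X] (RatFunc ℂ) P) ≠ 0 := (map_ne_zero_iff _ hinj).mpr h.ne_zero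
  have hP' : (algebraMap ℂ[X] (RatFunc ℂ) P') ≠ 0 := (map_ne_zero_iff _ hinj).mpr h'.ne_zero
  have hXm : (RatFunc.X : RatFunc ℂ) ^ m ≠ 0 := pow_ne_zero _ RatFunc.X_ne_zero
  apply hinj
  rw [map_mul, map_mul, map_pow, RatFunc.algebraMap_X]
  rw [rsLRat, rsLRat, hLm] at hkey
  field_simp at hkey
  linear_combination hkey

/-- **Uniqueness of the local `L`-polynomial** (Godement–Jacquet (1972), Thm. 3.3: the fractional
ideal of zeta integrals has a unique generator `P(q^{-s})⁻¹` with `P(0) = 1`): two polynomials with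
`HasGJLFactor ρ μG` coincide. From `HasGJLFactor.exists_X_pow_mul_eq` in both directions and
`polynomial_eq_of_laurent_unit`. This proves the uniqueness half of
`GodementJacquet1972_local_existsUnique_hasGJLFactor`. [cite: GodementJacquet1972, Thm. 3.3] -/
theorem HasGJLFactor.unique [MeasurableSpace (GL (Fin n) F)]
    {ρ : Representation ℂ (GL (Fin n) F) V} {μG : Measure (GL (Fin n) F)} {P P' : ℂ[X]}
    (h : HasGJLFactor ρ μG P) (h' : HasGJLFactor ρ μG P') : P = P' := by
  obtain ⟨a, i, ha⟩ := h.exists_X_pow_mul_eq h'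
  obtain ⟨b, j, hb⟩ := h'.exists_X_pow_mul_eq h
  exact polynomial_eq_of_laurent_unit h.eval_zero h'.eval_zero ha hb

/-- The existence half suffices: given uniqueness (`HasGJLFactor.unique`), the `∃!` of
`GodementJacquet1972_local_existsUnique_hasGJLFactor` follows from mere existence of an
`L`-polynomial. [folklore] -/
theorem existsUnique_hasGJLFactor_of_exists [MeasurableSpace (GL (Fin n) F)]
    {ρ : Representation ℂ (GL (Fin n) F) V} {μG : Measure (GL (Fin n) F)}
    (h : ∃ P : ℂ[X], HasGJLFactor ρ μG P) : ∃! P : ℂ[X], HasGJLFactor ρ μG P := by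
  obtain ⟨P, hP⟩ := h
  exact ⟨P, hP, fun P' hP' => hP'.unique hP⟩

end Uniqueness

/-! ### Named facts: Godement–Jacquet (1972), Thm. 3.3 and Lemma 6.10 -/

section Facts

variable {F : Type} [Field F] [ValuativeRel F] [TopologicalSpace F] [IsNonarchimedeanLocalField F]
  {n : ℕ}

/-- **Godement–Jacquet (1972), Thm. 3.3 (1): convergence of the local zeta integrals.** Let `π`
be an irreducible admissible representation of `GL_n(F)` and `μG` a Haar measure on `GL_n(F)`.
There is `s₀ ∈ ℝ` such that for every `Φ ∈ 𝒮(M_n(F))` and every coefficient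
`f = ⟨π(·) v, ṽ⟩` of `π` the integral `Z(Φ, s, f) = ∫ Φ(x) f(x) |det x|^s d×x` converges
absolutely for `re s > s₀` (Jacquet (1979), Prop. (1.2)(1); Gelbart (1975), p. 83 for `n = 2`).
[cite: GodementJacquet1972, Thm. 3.3 (1)] -/
def GodementJacquet1972_local_convergence : Prop :=
  ∀ [MeasurableSpace (GL (Fin n) F)] [BorelSpace (GL (Fin n) F)] (μG : Measure (GL (Fin n) F))
    [μG.IsHaarMeasure] {V : Type} [AddCommGroup V] [Module ℂ V]
    (ρ : Representation ℂ (GL (Fin n) F) V) [ρ.IsIrreducible] (_hρ : ρ.IsAdmissible),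
    ∃ s₀ : ℝ, ∀ Φ ∈ SchwartzBruhat (Matrix (Fin n) (Fin n) F), ∀ φ ∈ ρ.contragredient,
      ∀ (v : V) (s : ℂ), s₀ < s.re → Integrable (gjLocalIntegrand Φ (ρ.matrixCoeff φ v) s) μG

/-- **Godement–Jacquet (1972), Thm. 3.3 (2): rationality and the local `L`-factor.** Let `π` be
an irreducible admissible representation of `GL_n(F)` and `μG` a Haar measure on `GL_n(F)`. The
zeta integrals `Z(Φ, s + (n-1)/2, f)` (`Φ ∈ 𝒮(M_n(F))`, `f` a coefficient of `π`) are rational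
functions of `q^{-s}` and span a fractional ideal `L(s, π) ℂ[q^{-s}, q^{s}]` of `ℂ[q^{-s}, q^{s}]`
whose generator has the form `L(s, π) = P(q^{-s})⁻¹`, `P ∈ ℂ[X]`, `P(0) = 1`; such `P` is unique
(two generators differ by a unit `c T^k` of `ℂ[T, T⁻¹]`, and `P(0) = P'(0) = 1` forces
`P = P'`; proved in this file as `HasGJLFactor.unique`, so the content of this fact is the
existence, `existsUnique_hasGJLFactor_of_exists`). In the tree's predicate form:
`∃! P, HasGJLFactor ρ μG P` (Jacquet (1979), Prop. (1.2)(2)–(3); Gelbart (1975), p. 83 for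
`n = 2`). [cite: GodementJacquet1972, Thm. 3.3 (2)] -/
def GodementJacquet1972_local_existsUnique_hasGJLFactor : Prop :=
  ∀ [MeasurableSpace (GL (Fin n) F)] [BorelSpace (GL (Fin n) F)] (μG : Measure (GL (Fin n) F))
    [μG.IsHaarMeasure] {V : Type} [AddCommGroup V] [Module ℂ V]
    (ρ : Representation ℂ (GL (Fin n) F) V) [ρ.IsIrreducible] (_hρ : ρ.IsAdmissible),
    ∃! P : ℂ[X], HasGJLFactor ρ μG P

/-- **The unramified local `L`-factor** (Godement–Jacquet (1972), §6 (Lemma 6.10) with Thm. 3.3;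
Jacquet (1979), (1.4): for `π` unramified with Satake (Langlands) class `A`,
`L(s, π) = det(1 - A q^{-s})⁻¹`). Let `π` be an irreducible admissible representation of
`GL_n(F)` which is spherical for `K = GL_n(𝒪_F)` (`IsSpherical (glInt n F)`: `dim V^K = 1`) with
Satake parameter `α = {α_1, …, α_n}` with respect to a uniformizer `ϖ` (`|ϖ| = q⁻¹`;
`IsSatakeParameter`, unitary normalisation `T_i ↔ q^{i(n-i)/2} e_i(α)`). Then
`L(s, π) = ∏_i (1 - α_i q^{-s})⁻¹`, i.e. `HasGJLFactor ρ μG (eulerPolynomial α)` for every Haar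
measure `μG` (`eulerPolynomial α = ∏ (1 - α_i X)`, the polynomial of `partialStandardL`). The
spherical zeta integral `Z(1_{M_n(𝒪)}, s + (n-1)/2, ω°)` attains the factor
(`GodementJacquet1972_lemma610`), and every zeta integral of `π` lies in
`L(s, π) ℂ[q^{∓s}]` by Thm. 3.3 with the divisibility of `L(s, π)⁻¹` by `∏ (1 - α_i q^{-s})` for
subquotients of unramified principal series (loc. cit., §3).
[cite: GodementJacquet1972, Lemma 6.10 with Thm. 3.3] -/
def GodementJacquet1972_hasGJLFactor_of_isSatakeParameter : Prop :=
  ∀ [MeasurableSpace (GL (Fin n) F)] [BorelSpace (GL (Fin n) F)] (μG : Measure (GL (Fin n) F))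
    [μG.IsHaarMeasure] {V : Type} [AddCommGroup V] [Module ℂ V]
    (ρ : Representation ℂ (GL (Fin n) F) V) [ρ.IsIrreducible] (_hρ : ρ.IsAdmissible)
    (_hsph : ρ.IsSpherical (glInt n F)) {ϖ : Fˣ}
    (_hϖ : normAbs F (ϖ : F) = ((residueFieldCard F : ℝ≥0))⁻¹) {α : Multiset ℂ}
    (_hα : IsSatakeParameter ρ ϖ α),
    HasGJLFactor ρ μG (eulerPolynomial α)

/-- **Godement–Jacquet (1972), Lemma 6.10: the unramified computation** (Tamagawa (1963);
Jacquet (1979), (1.4); Shimura, Thm. 3.21 for the Hecke series). Let `π` be irreducible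
admissible on `V` and spherical (`dim V^K = 1`, `K = GL_n(𝒪_F)`, so that the `K`-fixed vector of
`IsSatakeParameter` is a multiple of any non-zero `v ∈ V^K`), `ϖ` a uniformizer (`|ϖ| = q⁻¹`),
`α` a Satake parameter of `π` (`IsSatakeParameter ρ ϖ α`, unitary normalisation), `v ∈ V^K` and
`ṽ ∈ (V^*)^K` with `ṽ(v) = 1` (so `ω°(g) = ṽ(π(g) v) = ρ.matrixCoeff ṽ v` is the zonal spherical
coefficient, `ω°(1) = 1`), and let the Haar measure `μG` give `K` volume `1`. Then for `re s`
large the integral `Z(1_{M_n(𝒪_F)}, s + (n-1)/2, ω°)` converges absolutely and equals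
`∏_i (1 - α_i q^{-s})⁻¹ = (eulerPolynomial α)(q^{-s})⁻¹`: summing `λ_t |det t|^{s'}` over the
`K`-double cosets `K t K ⊆ M_n(𝒪_F)` gives Tamagawa's Hecke series
`(∑_i (-1)^i q^{i(i-1)/2} T_i X^i)⁻¹` at `X = q^{-s'}`, whose denominator under
`T_i ↦ q^{i(n-i)/2} e_i(α)` is `∏_j (1 - q^{(n-1)/2} α_j X) = ∏_j (1 - α_j q^{-s})` for
`s' = s + (n-1)/2` (module docstring, "Conventions check").
[cite: GodementJacquet1972, Lemma 6.10] -/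
def GodementJacquet1972_lemma610 : Prop :=
  ∀ [MeasurableSpace (GL (Fin n) F)] [BorelSpace (GL (Fin n) F)] (μG : Measure (GL (Fin n) F))
    [μG.IsHaarMeasure] (_hμ : μG (glInt n F : Set (GL (Fin n) F)) = 1)
    {V : Type} [AddCommGroup V] [Module ℂ V]
    (ρ : Representation ℂ (GL (Fin n) F) V) [ρ.IsIrreducible] (_hρ : ρ.IsAdmissible)
    (_hsph : ρ.IsSpherical (glInt n F))
    {ϖ : Fˣ} (_hϖ : normAbs F (ϖ : F) = ((residueFieldCard F : ℝ≥0))⁻¹) {α : Multiset ℂ}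
    (_hα : IsSatakeParameter ρ ϖ α) {v : V} (_hv : v ∈ ρ.fixedPoints (glInt n F))
    {φ : Module.Dual ℂ V} (_hφ : φ ∈ ρ.dual.fixedPoints (glInt n F)) (_h1 : φ v = 1),
    ∃ c : ℝ, ∀ s : ℂ, c < s.re →
      Integrable (gjLocalIntegrand ((intMatrices n F).indicator 1) (ρ.matrixCoeff φ v)
        (s + ((n : ℂ) - 1) / 2)) μG ∧
      gjLocalZeta μG ((intMatrices n F).indicator 1) (ρ.matrixCoeff φ v)
          (s + ((n : ℂ) - 1) / 2) =
        ((eulerPolynomial α).eval ((residueFieldCard F : ℂ) ^ (-s)))⁻¹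

end Facts

end Literature.NumberTheory.Automorphic
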